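import Mathlib
import HarnessLib
import Summits.KontsevichZagierPeriods.Zeta5Search.DougallComplexParameters

/-!
# ζ(5) search — absolute convergence of Zudilin's very-well-poised series `F_m` at complex parameters (cell `pub-zeta5`, ct-1 g27)

HONEST FRAMING: systematic search; no irrationality claim unless kernel-certified.  A summability statement for a hypergeometric
series (inline, general `m`); nothing here is an irrationality result, a worthiness exponent or a denominator statement; no named
fact is discharged; no definition is introduced.

Brick B4' of `HOME/ct-1/g27/VWP-BLUEPRINT-g27.md`: the terms of
`F_m(h₀;h₁,…,h_m) = Σ_μ (h₀+2μ) ∏_{j=0}^{m} Γ(h_j+μ)/Γ(1+h₀−h_j+μ) · (−1)^{(m+1)μ}` (Zudilin math/0206177 (1)) at COMPLEX parameters with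
`Re h_j > 0`, `Re(1+h₀−h_j) > 0` satisfy `‖term_μ‖ ≤ K μ^{E}` for large `μ`, with the same exponent
`E = 2 Σ_{j=1}^m Re h_j − (m−1) Re h₀ − m` as the Barnes kernel (`VWPBarnesKernel.exponent_eq`); hence the series converges
absolutely EXACTLY under the printed (5), `2 Σ_{j=1}^m Re h_j < (m−1)(1 + Re h₀)` (Zudilin's Remark after (7)).  General-`m`,
complex-parameter version of g26's `DougallCoefficientBounds.summable_dougallCoeff` / `DougallComplexH0.summable_gammaRatios`.

* `norm_Gamma_ratio_le` — one factor: `‖Γ(ζ+μ)/Γ(ξ+μ)‖ ≤ C μ^{Re ζ − Re ξ}` (`μ ≥ 1`, `μ ≥ Re ζ`), from g26's `norm_Gamma_add_nat_le`,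
  `norm_inv_Gamma_add_nat_le`, `Gamma_ratio_le`;
* `norm_prod_Gamma_ratio_le` — the Finset product; `exponent_eq'`; **`summable_vwpTerm`**.

Theorems only; imports `Zeta5Search/DougallComplexParameters`.
-/

noncomputable section

namespace Summit.KontsevichZagierPeriods.Zeta5Search.VWPSeriesSummable

open Finset
open Summit.KontsevichZagierPeriods.Zeta5Search

/-- **One Gamma ratio**: for `Re ζ > 0`, `Re ξ > 0`, `μ ≥ 1`, `μ ≥ Re ζ`:
`‖Γ(ζ+μ)/Γ(ξ+μ)‖ ≤ (‖Γ(ξ)⁻¹‖ Γ(Re ξ) 2^{1+Re ζ}) · μ^{Re ζ − Re ξ}`. -/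
theorem norm_Gamma_ratio_le {ζ ξ : ℂ} (hζ : 0 < ζ.re) (hξ : 0 < ξ.re) {μ : ℕ} (hμ1 : 1 ≤ (μ : ℝ)) (hμζ : ζ.re ≤ (μ : ℝ)) :
    ‖Complex.Gamma (ζ + μ) / Complex.Gamma (ξ + μ)‖ ≤
      (‖(Complex.Gamma ξ)⁻¹‖ * Real.Gamma ξ.re * (2 : ℝ) ^ (1 + ζ.re)) * (μ : ℝ) ^ (ζ.re - ξ.re) := by
  have h1 := DougallParameterHolomorphy.norm_Gamma_add_nat_le hζ μ
  have h2 := DougallComplexParameters.norm_inv_Gamma_add_nat_le hξ μ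
  rw [← DougallCoefficientBounds.Gamma_add_nat_eq ζ.re hζ μ] at h1
  have hprod : 0 < ∏ i ∈ range μ, (ξ.re + i) := prod_pos fun i _ => by positivity
  have hΓξμ : Real.Gamma (ξ.re + μ) = Real.Gamma ξ.re * ∏ i ∈ range μ, (ξ.re + i) :=
    DougallCoefficientBounds.Gamma_add_nat_eq ξ.re hξ μ
  have hratio := DougallCoefficientBounds.Gamma_ratio_le (x := (μ : ℝ)) (a := ζ.re) (b := ξ.re) hμ1 hμζ hζ.le hξ.le
  have hΓpos : 0 < Real.Gamma (ξ.re + μ) := Real.Gamma_pos_of_pos (by positivity)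
  have hΓξ : 0 < Real.Gamma ξ.re := Real.Gamma_pos_of_pos hξ
  rw [norm_div, div_eq_mul_inv, ← norm_inv]
  calc ‖Complex.Gamma (ζ + μ)‖ * ‖(Complex.Gamma (ξ + μ))⁻¹‖
      ≤ Real.Gamma (ζ.re + μ) * (‖(Complex.Gamma ξ)⁻¹‖ / ∏ i ∈ range μ, (ξ.re + i)) :=
        mul_le_mul h1 h2 (norm_nonneg _) (Real.Gamma_pos_of_pos (by positivity)).le
    _ = ‖(Complex.Gamma ξ)⁻¹‖ * Real.Gamma ξ.re * (Real.Gamma ((μ : ℝ) + ζ.re) / Real.Gamma ((μ : ℝ) + ξ.re)) := by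
        rw [add_comm (μ : ℝ) ζ.re, add_comm (μ : ℝ) ξ.re, hΓξμ]
        field_simp
    _ ≤ ‖(Complex.Gamma ξ)⁻¹‖ * Real.Gamma ξ.re * ((2 : ℝ) ^ (1 + ζ.re) * (μ : ℝ) ^ (ζ.re - ξ.re)) :=
        mul_le_mul_of_nonneg_left hratio (by positivity)
    _ = _ := by ring

/-- **The product of ratios**: for a finite set `S` of indices with `Re ζ_j, Re ξ_j > 0`, there is `C > 0` with
`∏_{j∈S} ‖Γ(ζ_j+μ)/Γ(ξ_j+μ)‖ ≤ C μ^{Σ_{j∈S}(Re ζ_j − Re ξ_j)}` whenever `μ ≥ 1` and `μ ≥ Re ζ_j` for all `j ∈ S`. -/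
theorem norm_prod_Gamma_ratio_le (S : Finset ℕ) (ζ ξ : ℕ → ℂ) (hζ : ∀ j ∈ S, 0 < (ζ j).re) (hξ : ∀ j ∈ S, 0 < (ξ j).re) :
    ∃ C : ℝ, 0 < C ∧ ∀ μ : ℕ, 1 ≤ (μ : ℝ) → (∀ j ∈ S, (ζ j).re ≤ (μ : ℝ)) →
      ∏ j ∈ S, ‖Complex.Gamma (ζ j + μ) / Complex.Gamma (ξ j + μ)‖ ≤ C * (μ : ℝ) ^ (∑ j ∈ S, ((ζ j).re - (ξ j).re)) := by
  classical
  induction S using Finset.induction_on with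
  | empty => exact ⟨1, one_pos, fun μ _ _ => by simp⟩
  | insert a S ha ih =>
    obtain ⟨C₁, hC₁, h₁⟩ := ih (fun j hj => hζ j (mem_insert_of_mem hj)) (fun j hj => hξ j (mem_insert_of_mem hj))
    have hζa := hζ a (mem_insert_self a S)
    have hξa := hξ a (mem_insert_self a S)
    have hΓ : Complex.Gamma (ξ a) ≠ 0 := Complex.Gamma_ne_zero_of_re_pos hξa
    refine ⟨(‖(Complex.Gamma (ξ a))⁻¹‖ * Real.Gamma (ξ a).re * (2 : ℝ) ^ (1 + (ζ a).re)) * C₁,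
      mul_pos (mul_pos (mul_pos (norm_pos_iff.2 (inv_ne_zero hΓ)) (Real.Gamma_pos_of_pos hξa)) (by positivity)) hC₁,
      fun μ hμ1 hμ => ?_⟩
    have hμ0 : 0 < (μ : ℝ) := by linarith
    rw [prod_insert ha, sum_insert ha, Real.rpow_add hμ0]
    calc ‖Complex.Gamma (ζ a + μ) / Complex.Gamma (ξ a + μ)‖ * ∏ j ∈ S, ‖Complex.Gamma (ζ j + μ) / Complex.Gamma (ξ j + μ)‖
        ≤ ((‖(Complex.Gamma (ξ a))⁻¹‖ * Real.Gamma (ξ a).re * (2 : ℝ) ^ (1 + (ζ a).re)) * (μ : ℝ) ^ ((ζ a).re - (ξ a).re)) *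
          (C₁ * (μ : ℝ) ^ (∑ j ∈ S, ((ζ j).re - (ξ j).re))) :=
          mul_le_mul (norm_Gamma_ratio_le hζa hξa hμ1 (hμ a (mem_insert_self a S)))
            (h₁ μ hμ1 fun j hj => hμ j (mem_insert_of_mem hj)) (prod_nonneg fun _ _ => norm_nonneg _) (by positivity)
      _ = _ := by ring

/-- The exponent in Zudilin's form (as in `VWPBarnesKernel.exponent_eq`):
`1 + Σ_{j≤m}(Re h_j − Re(1+h₀−h_j)) = 2Σ_{j=1}^m Re h_j − (m−1)Re h₀ − m`. -/
theorem exponent_eq' (m : ℕ) (h : ℕ → ℂ) :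
    1 + (∑ j ∈ range (m + 1), ((h j).re - (1 + h 0 - h j).re)) =
      2 * (∑ j ∈ range m, (h (j + 1)).re) - ((m : ℝ) - 1) * (h 0).re - m := by
  rw [sum_range_succ']
  simp only [sum_sub_distrib, sum_const, card_range, nsmul_eq_mul, Complex.add_re, Complex.sub_re, Complex.one_re]
  ring

/-- **Absolute convergence of `F_m` at complex parameters, exactly under (5)** [Zudilin math/0206177, (1), (5) and the Remark
after (7)]: for `Re h_j > 0` and `Re(1+h₀−h_j) > 0` (`j ≤ m`) and `2 Σ_{j=1}^m Re h_j < (m−1)(1 + Re h₀)`, the series of the terms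
`(h₀+2μ) ∏_{j≤m} Γ(h_j+μ)/Γ(1+h₀−h_j+μ) · (−1)^{(m+1)μ}` is summable. -/
theorem summable_vwpTerm (m : ℕ) (h : ℕ → ℂ) (hpos : ∀ j, j ≤ m → 0 < (h j).re)
    (hden : ∀ j, j ≤ m → 0 < (1 + h 0 - h j).re)
    (h5 : 2 * (∑ j ∈ range m, (h (j + 1)).re) < ((m : ℝ) - 1) * (1 + (h 0).re)) :
    Summable fun μ : ℕ => (h 0 + 2 * μ) *
      (∏ j ∈ range (m + 1), Complex.Gamma (h j + μ) / Complex.Gamma (1 + h 0 - h j + μ)) * (-1 : ℂ) ^ ((m + 1) * μ) := by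
  have hS : ∀ j ∈ range (m + 1), j ≤ m := fun j hj => Nat.lt_succ_iff.1 (mem_range.1 hj)
  obtain ⟨C, hC, hprod⟩ := norm_prod_Gamma_ratio_le (range (m + 1)) h (fun j => 1 + h 0 - h j)
    (fun j hj => hpos j (hS j hj)) (fun j hj => hden j (hS j hj))
  set E : ℝ := 1 + (∑ j ∈ range (m + 1), ((h j).re - (1 + h 0 - h j).re)) with hE
  have hE1 : E < -1 := by rw [hE, exponent_eq']; linarith
  have hg : Summable fun μ : ℕ => (‖h 0‖ + 2) * C * (μ : ℝ) ^ E := (Real.summable_nat_rpow.2 hE1).mul_left _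
  refine Summable.of_norm_bounded_eventually_nat hg ?_
  rw [Filter.eventually_atTop]
  refine ⟨⌈1 + ∑ j ∈ range (m + 1), (h j).re⌉₊, fun μ hμ => ?_⟩
  have hμR : 1 + ∑ j ∈ range (m + 1), (h j).re ≤ (μ : ℝ) := le_trans (Nat.le_ceil _) (by exact_mod_cast hμ)
  have hsum0 : 0 ≤ ∑ j ∈ range (m + 1), (h j).re := sum_nonneg fun j hj => (hpos j (hS j hj)).le
  have hμ1 : 1 ≤ (μ : ℝ) := by linarith
  have hμ0 : 0 < (μ : ℝ) := by linarith
  have hμj : ∀ j ∈ range (m + 1), (h j).re ≤ (μ : ℝ) := fun j hj => by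
    have := single_le_sum (f := fun j => (h j).re) (fun i hi => (hpos i (hS i hi)).le) hj
    linarith
  have hP := hprod μ hμ1 hμj
  have hlin : ‖h 0 + 2 * (μ : ℂ)‖ ≤ (‖h 0‖ + 2) * (μ : ℝ) ^ (1 : ℝ) := by
    rw [Real.rpow_one]
    calc ‖h 0 + 2 * (μ : ℂ)‖ ≤ ‖h 0‖ + ‖(2 : ℂ) * (μ : ℂ)‖ := norm_add_le _ _
      _ = ‖h 0‖ + 2 * μ := by rw [norm_mul, Complex.norm_two, Complex.norm_natCast]
      _ ≤ (‖h 0‖ + 2) * μ := by nlinarith [norm_nonneg (h 0)]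
  rw [norm_mul, norm_mul, norm_pow, norm_neg, norm_one, one_pow, mul_one, norm_prod]
  calc ‖h 0 + 2 * (μ : ℂ)‖ * ∏ j ∈ range (m + 1), ‖Complex.Gamma (h j + μ) / Complex.Gamma (1 + h 0 - h j + μ)‖
      ≤ ((‖h 0‖ + 2) * (μ : ℝ) ^ (1 : ℝ)) * (C * (μ : ℝ) ^ (∑ j ∈ range (m + 1), ((h j).re - (1 + h 0 - h j).re))) :=
        mul_le_mul hlin hP (prod_nonneg fun _ _ => norm_nonneg _) (by positivity)
    _ = (‖h 0‖ + 2) * C * (μ : ℝ) ^ E := by rw [hE, Real.rpow_add hμ0]; ring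

end Summit.KontsevichZagierPeriods.Zeta5Search.VWPSeriesSummable

end
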